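import Literature.Analysis.FunctionSpaces.PoissonMeckeProofs
import HarnessLib

/-!
# Poisson point processes: almost sure finiteness, almost surely distinct values of a diffuse mark
(topic Analysis/FunctionSpaces, next to `PoissonPointProcess` / `PoissonMecke`; serves the definition
`Literature.Analysis.FunctionSpaces.chordalNearest` — almost sure uniqueness of the chordal-nearest point of a
Poisson configuration — requested by route `ConformalPoissonDevice` of `CriticalPhenomena/Ising3DConformalLimit`)

Two consequences of Kingman's axioms (`Literature.Analysis.FunctionSpaces.IsPoissonPointProcess ν P`) for a law
`P` on locally finite simple configurations:

* `IsPoissonPointProcess.ae_finite`: if the intensity is finite, `ν E < ∞`, the configuration is a.s. a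
  finite set (the total count `N(E)` is Poisson with finite mean; Kingman 1993 §2.1).
* `IsPoissonPointProcess.ae_injOn`: if `g : E → β` is measurable and every fibre `g⁻¹{t}` is `ν`-null,
  then a.s. no two distinct points of the configuration share a `g`-value (`g` is injective on the
  configuration). Proof by the (univariate) Mecke equation (Last–Penrose 2017, Thm 4.1; in the tree as
  `IsPoissonPointProcess.lintegral_lintegral_toMeasure_eq`) applied to
  `f(c, a) = N_c(g⁻¹{g a} ∖ {a})`, the number of *other* points of `c` in the fibre of `a`:
  `𝔼 ∑_{a ∈ c} f(c, a) = ∫ 𝔼 N_c(g⁻¹{g a} ∖ {a}) ν(da) = ∫ ν(g⁻¹{g a} ∖ {a}) ν(da) = 0`, so a.s. every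
  `f(c, a)`, `a ∈ c`, vanishes. With `g = dist x` this is the classical "a.s. no two points of a Poisson
  process with diffuse radial intensity are equidistant from `x`"; with `g` the chordal criterion
  `‖x - ·‖² / (1 + ‖·‖²)` it gives a.s. uniqueness of the chordal-nearest point (`ChordalNearest`).

Setting for `ae_injOn`: `E` second countable Hausdorff σ-compact Borel (so that the counting kernel of
`PointConfigKernel` is available), `ν` σ-finite.

## References

* G. Last, M. Penrose, *Lectures on the Poisson Process*, Cambridge Univ. Press (2017), Thm 4.1.
* J. F. C. Kingman, *Poisson Processes*, Oxford (1993), §2.1.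
-/

open MeasureTheory ProbabilityTheory Set
open scoped ENNReal

namespace Literature.Analysis.FunctionSpaces

namespace IsPoissonPointProcess

universe u

variable {E : Type u} [TopologicalSpace E] [MeasurableSpace E] {ν : Measure E}
  {P : Measure (PointConfig E)}

/-- **A Poisson process with finite intensity is a.s. a finite configuration**: `N(E) ~ Po(ν E)` is
a.s. finite when `ν E < ∞` (Kingman 1993, §2.1). [cite: Kingman1993, §2.1] -/
theorem ae_finite (h : IsPoissonPointProcess ν P) (hν : ν univ ≠ ∞) :
    ∀ᵐ c ∂P, ((c : PointConfig E) : Set E).Finite := by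
  filter_upwards [h.count_ae_lt_top MeasurableSet.univ hν] with c hc
  rw [PointConfig.count, inter_univ] at hc
  exact Set.encard_lt_top_iff.1 hc

variable [T2Space E] [SecondCountableTopology E] [BorelSpace E] [SigmaCompactSpace E]

/-- **Almost surely, distinct points of a Poisson process have distinct values under a mark with
diffuse fibres.** If `g : E → β` is measurable and `ν (g⁻¹{t}) = 0` for every `t`, then for `P`-a.e.
configuration `c`, `g` is injective on `c`. Mecke's equation (Last–Penrose 2017, Thm 4.1) with
`f(c, a) = N_c(g⁻¹{g a} ∖ {a})` gives `𝔼 ∑_{a ∈ c} f(c, a) = ∫ ν(g⁻¹{g a} ∖ {a}) ν(da) = 0`.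
[cite: LastPenrose2017, Thm 4.1] -/
theorem ae_injOn [SigmaFinite ν] (h : IsPoissonPointProcess ν P) {β : Type*} [MeasurableSpace β]
    [MeasurableEq β] {g : E → β} (hg : Measurable g) (hν : ∀ t, ν (g ⁻¹' {t}) = 0) :
    ∀ᵐ c ∂P, Set.InjOn g ((c : PointConfig E) : Set E) := by
  haveI := h.isProbabilityMeasure
  -- the set of "other points in the same fibre", parametrised by `(c, a)`
  set T : Set ((PointConfig E × E) × E) := {p | g p.2 = g p.1.2 ∧ p.2 ≠ p.1.2} with hT
  have hTm : MeasurableSet T := by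
    refine MeasurableSet.inter ?_ ?_
    · exact measurableSet_eq_fun (hg.comp measurable_snd)
        (hg.comp (measurable_snd.comp measurable_fst))
    · exact (measurableSet_eq_fun measurable_snd (measurable_snd.comp measurable_fst)).compl
  have hslice : ∀ (c : PointConfig E) (a : E), Prod.mk (c, a) ⁻¹' T = g ⁻¹' {g a} \ {a} := by
    intro c a
    ext b
    simp [hT]
  have hS : ∀ a : E, MeasurableSet (g ⁻¹' {g a} \ {a}) := fun a =>
    (hg (measurableSet_singleton _)).diff (measurableSet_singleton a)
  have hνS : ∀ a : E, ν (g ⁻¹' {g a} \ {a}) = 0 := fun a =>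
    measure_mono_null sdiff_subset (hν (g a))
  -- `f (c, a) = N_c(g⁻¹{g a} ∖ {a})`, jointly measurable by the counting kernel
  set f : PointConfig E × E → ℝ≥0∞ := fun p => p.1.toMeasure (Prod.mk p ⁻¹' T) with hf
  have hfm : Measurable f := PointConfig.measurable_toMeasure_preimage hTm measurable_fst
  have hf_apply : ∀ (c : PointConfig E) (a : E),
      f (c, a) = ((c.count (g ⁻¹' {g a} \ {a}) : ℕ∞) : ℝ≥0∞) := fun c a => by
    simp only [hf]
    rw [hslice, PointConfig.toMeasure_apply _ (hS a)]
  -- the right-hand side of Mecke's equation vanishes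
  have hR : ∫⁻ a, ∫⁻ c, f (c ∪ PointConfig.ofFn (fun _ : Fin 1 => a), a) ∂P ∂ν = 0 := by
    have hRa : ∀ a, ∫⁻ c, f (c ∪ PointConfig.ofFn (fun _ : Fin 1 => a), a) ∂P = 0 := by
      intro a
      classical
      calc ∫⁻ c, f (c ∪ PointConfig.ofFn (fun _ : Fin 1 => a), a) ∂P
          = ∫⁻ c, ((c.count (g ⁻¹' {g a} \ {a}) : ℕ∞) : ℝ≥0∞) ∂P := by
            refine lintegral_congr fun c => ?_
            rw [hf_apply, PointConfig.count_union_ofFn_one]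
            simp
        _ = ν (g ⁻¹' {g a} \ {a}) :=
            h.lintegral_count (hS a) (by rw [hνS]; exact ENNReal.zero_ne_top)
        _ = 0 := hνS a
    simp [hRa]
  -- hence so does the left-hand side, almost surely
  have hL : ∀ᵐ c ∂P, ∫⁻ a, f (c, a) ∂c.toMeasure = 0 := by
    have h0 : ∫⁻ c, ∫⁻ a, f (c, a) ∂c.toMeasure ∂P = 0 := by
      rw [h.lintegral_lintegral_toMeasure_eq hfm, hR]
    have hmeas : Measurable fun c : PointConfig E => ∫⁻ a, f (c, a) ∂c.toMeasure :=
      PointConfig.measurable_lintegral_toMeasure hfm measurable_id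
    exact (lintegral_eq_zero_iff hmeas).1 h0
  filter_upwards [hL] with c hc
  rw [PointConfig.lintegral_toMeasure] at hc
  have hzero : ∀ a ∈ c, c.count (g ⁻¹' {g a} \ {a}) = 0 := fun a ha => by
    have h1 := ENNReal.tsum_eq_zero.1 hc ⟨a, ha⟩
    rwa [hf_apply, ENat.toENNReal_eq_zero] at h1
  intro a ha b hb hab
  by_contra hne
  have h2 := hzero a ha
  rw [PointConfig.count, Set.encard_eq_zero] at h2
  have hb' : b ∈ c.carrier ∩ (g ⁻¹' {g a} \ {a}) :=
    ⟨hb, by simpa using hab.symm, fun hba => hne (mem_singleton_iff.1 hba).symm⟩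
  rw [h2] at hb'
  exact hb'

end IsPoissonPointProcess

end Literature.Analysis.FunctionSpaces
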